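import Mathlib
import Literature.Geometry.Lorentzian.PseudoRiemannianMetric
import Literature.Geometry.Lorentzian.LeviCivita
import Literature.Geometry.Lorentzian.Geodesic
import Literature.Geometry.Riemannian.ConstantCurvature
import HarnessLib

/-!
# Hyperbolic complements of tori in (manifolds homeomorphic to) the 4-sphere
# (Ivanšić 2004; Ivanšić–Ratcliffe–Tschantz 2005, Thm. 4.4; Ivanšić 2012; Saratchandran 2015)

Topic `Topology/FourManifolds`; namespace `Literature.Topology.FourManifolds`.  Two NAMED FACTS
(D-0014), the explicit "hyperbolic origin" instances behind the crux
`Summit.SmoothPoincare4.SmoothPoincare4.Theses.HyperbolicTorusFillings.HyperbolicFillingsStandard`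
(route `HyperbolicTorusFillings`), typed with that crux's hyperbolicity clause verbatim.

Sources (held texts `paper:arxiv-math_0502293`, `paper:arxiv-1503.07778`).

> **Ivanšić–Ratcliffe–Tschantz**, *Complements of tori and Klein bottles in the 4-sphere that have
> hyperbolic structure*, Algebr. Geom. Topol. 5 (2005) 999–1026 (arXiv:math/0502293).
> §1: "A hyperbolic manifold of interest in this paper is also complete, noncompact and has finite
> volume … Ivanšić [Ivansic3] … it was shown that `M̃_1011`, the orientable double cover of one of
> the 1049 nonorientable hyperbolic 4-manifolds that Ratcliffe and Tschantz constructed, is a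
> complement of 5 tori in `S⁴`."  **Theorem 4.4.** "The orientable double covers of the
> nonorientable Ratcliffe–Tschantz manifolds listed in Table 1 are complements of the indicated
> combination of tori and Klein bottles in a manifold that is homeomorphic to the 4-sphere."
> **Remark 4.5.** "… homeomorphic to the 4-sphere, rather than diffeomorphic. This is because we
> used Freedman's theory … It is still unknown whether manifolds homeomorphic to the 4-sphere are
> diffeomorphic to the `S⁴` with the standard differentiable structure."  Proof of Thm. 4.4,
> Example 4.7: "The boundary components of `M̃_1091` are AAAAAAAAA, making it a complement of 9
> tori" (type A = the 3-torus); closing remarks: "the orientable double covers from (Thm. 4.4)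
> whose boundary components are all 3-tori (i.e. which are complements of a collection of tori in
> `S⁴`), namely `M̃_71`, `M̃_23`, `M̃_1092` and `M̃_1091`."
> **Saratchandran**, *A four dimensional hyperbolic link complement in a standard `S⁴`*
> (arXiv:1503.07778), Theorem (main): "There exists a collection `L` of five linked 2-tori
> embedded in a smooth 4-manifold `X` such that `X` is diffeomorphic to a standard `S⁴`, and
> `X − L` admits a finite volume hyperbolic geometry."  (ibid.: "D. Ivanšić proves in his paper
> [ivansic] (see thm. 4.3, p. 18) that there exists a system of five linked tori embedded in a
> smooth manifold `X` that is homeomorphic to `S⁴` such that `X − L` admits a finite volume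
> hyperbolic geometry … he does not prove that `X` is diffeomorphic to `S⁴`.")
> **Ivanšić**, *A topological 4-sphere that is standard*, Adv. Geom. 12 (2012) 461–482
> (doi:10.1515/advgeom-2012-0004; paywalled, acquisition requested 2026-08-15) is the earlier,
> PUBLISHED proof of the same diffeomorphism statement for the same filling of `M̃_1011` (Saratchandran
> 2015, p. 4, was "unaware of the existence" of Ivanšić's later work and cites only Ivanšić 2004).  As
> restated in the survey **Martelli**, *Hyperbolic four-manifolds* (arXiv:1512.03661), §3.3, p. 12 (held
> text `paper:arxiv-1512.03661`, p0012): "These homotopy 4-spheres are homeomorphic to `S⁴` thanks to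
> Freedman's Theorem, but might a priori be not diffeomorphic to it.  Later on, Ivanšić proved [Iv2] that
> one of these homotopy spheres is indeed diffeomorphic to `S⁴`. We therefore know that `S⁴` contains a
> hyperbolic link of 5 tori." ([Iv2] = Adv. Geom. 12 (2012) 461–482.)

## The two facts

* `exists_fiveTori_hyperbolic_complement_sphereFour` — **Ivanšić 2012 / Saratchandran 2015, Thm. 4.1**
  (with Ivanšić 2004 Thm. 4.3 for the hyperbolic structure), transported along the diffeomorphism
  `X ≅ S⁴`: there are
  five pairwise disjoint smoothly embedded tori `T_i : S¹ × S¹ ↪ S⁴` in the STANDARD smooth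
  4-sphere (`Metric.sphere 0 1 ⊆ ℝ⁵` with Mathlib's structure) whose complement `U`, an open
  submanifold of `S⁴`, carries a complete Riemannian metric of constant sectional curvature `−1`.
  This is the settled instance of the crux (the canonical filling of `M̃_1011` is standard).
* `exists_toriComplement_homeomorphic_sphereFour` — **Ivanšić–Ratcliffe–Tschantz 2005, Thm. 4.4**,
  the two all-tori rows whose link structure is spelled out in the held text (`M̃_1011`: 5 tori,
  §1; `M̃_1091`: 9 tori, Example 4.7): for `r ∈ {5, 9}` there is a smooth closed 4-manifold `N`
  (Hausdorff, second countable, compact, `C^∞`, modelled on `ℝ⁴`) HOMEOMORPHIC to `S⁴`, and `r`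
  pairwise disjoint smoothly embedded tori in `N`, whose complement carries a complete Riemannian
  metric of constant sectional curvature `−1` (smooth structure of `N`; the smooth type of `N` is
  not asserted — Remark 4.5).

## Faithfulness notes

* **Hyperbolicity clause.** Exactly the clause of the crux `HyperbolicFillingsStandard`: a
  `Literature.Geometry.Lorentzian.PseudoRiemannianMetric (𝓡 4) ∞ ℝ⁴ (TangentSpace (𝓡 4))` on the
  open submanifold `U` which `IsRiemannian`, `HasConstantSectionalCurvature (-1)`
  (`Literature/Geometry/Riemannian/ConstantCurvature.lean`, Lee Prop. 8.36), and all of whose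
  Levi-Civita connections are `IsGeodesicallyComplete`.  **Finite volume is NOT stated** (the tree
  has no Riemannian volume; the route omits it for the same reason) — a weakening.  "Admits a
  hyperbolic geometry / structure" for the smooth manifold `X − L` (resp. `M̃`) means a complete
  hyperbolic Riemannian metric on that smooth manifold; for Saratchandran's theorem the smooth
  structure on `S⁴ ∖ ∪T_i` is the one induced from the standard `S⁴` because `X` is DIFFEOMORPHIC to
  the standard sphere and `L ⊆ X` is a smooth sublink; for Thm. 4.4 it is the structure of the
  filled manifold `N ⊇ M̃` (the tori are the smooth cores of the filling), hence the abstract `N`.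
* **"Complement of tori".**  The filling construction (IRT §2–3, [Ivansic2]) closes each `T³` cusp
  along an `S¹`-fibration, so `N ∖ M̃` is a disjoint union of smoothly embedded 2-tori and
  `M̃ = N ∖ ∪ T_i`; we render the tori as smooth embeddings `S¹ × S¹ → N`
  (`Manifold.IsSmoothEmbedding`, circle `= Metric.sphere 0 1 ⊆ ℝ²` with `𝓡 1`, as in the route file)
  with pairwise disjoint images, and `U` as any `TopologicalSpace.Opens` with carrier the complement
  (the `∀ U, ↑U = (⋃ range T_i)ᶜ → …` binder is the route's device for naming the open submanifold).
* **Rows not restated.**  Table 1 of IRT lists twelve manifolds, several with Klein-bottle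
  components (e.g. `M̃_56`: 4 tori and 3 Klein bottles, Example 4.6; `M̃_36`: 6 tori and 2 Klein
  bottles, Example 4.8); Mathlib has no Klein bottle, and the extracted text of the held copy does not
  reproduce Table 1, so only the two rows whose data are printed in prose are vendored.  Example 4.8's
  "infinitely many admissible choices of translations" and Example 4.10 (covers in simply connected
  `N` with `χ = 2n`) are not restated.
* Mathlib: `Metric.sphere` as a smooth manifold (`EuclideanSpace.instChartedSpaceSphere`),
  `Manifold.IsSmoothEmbedding`, `TopologicalSpace.Opens` submanifolds, `Homeomorph`; no hyperbolic
  manifolds, no Dehn filling, no Klein bottle (`rg -i "Klein bottle|hyperbolic manifold"` over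
  Mathlib: nothing).  Tree: the route file's `circlePoint` is not needed here.

## References

* D. Ivanšić, *Hyperbolic structure on a complement of tori in the 4-sphere*, Adv. Geom. 4 (2004)
  119–139, Thm. 4.3. [Ivansic2004]
* D. Ivanšić, J. G. Ratcliffe, S. T. Tschantz, Algebr. Geom. Topol. 5 (2005) 999–1026, Thm. 4.4,
  Rem. 4.5, Ex. 4.7. [IvansicRatcliffeTschantz2005]
* D. Ivanšić, *A topological 4-sphere that is standard*, Adv. Geom. 12 (2012) 461–482,
  doi:10.1515/advgeom-2012-0004 (the published proof; text not held). [Ivansic2012]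
* H. Saratchandran, arXiv:1503.07778 (2015), Theorem 4.1 (= "Theorem (mainthm_1)" of §1; arXiv
  preprint, independent proof by Kirby calculus; the companion arXiv:1503.06722 appeared in Topology
  Appl. 202 (2016)). [Saratchandran2015]
* B. Martelli, *Hyperbolic four-manifolds*, arXiv:1512.03661 (survey; in *Handbook of Group Actions
  III*, 2018), §3.3, p. 12. [Martelli2015]

## Size of a Lean proof (literature-prover triage 2026-08-15: XL)

Discharging `exists_fiveTori_hyperbolic_complement_sphereFour` needs, none of which exists in Mathlib or
this tree: hyperbolic 4-space with its curvature and completeness in the `PseudoRiemannianMetric` API;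
the torsion-free discrete group of census manifold 1011 (24-cell side pairings) and the quotient
`H⁴/Γ`; five explicit tori in the standard `S⁴` and a DIFFEOMORPHISM of their complement with `H⁴/Γ`
(the Kirby-calculus content of Ivanšić 2012 / Saratchandran 2015 §4).  What IS available: any proof may
check the hyperbolicity clause on ONE Levi-Civita connection
(`Literature.Geometry.Lorentzian.PseudoRiemannianMetric.IsLeviCivita.hasConstantSectionalCurvature`,
`….IsLeviCivita.forall_isGeodesicallyComplete`, file `Geometry/Lorentzian/GeodesicLeviCivita.lean`).
-/

noncomputable section

open scoped Manifold ContDiff Topology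
open Set TopologicalSpace

namespace Literature.Topology.FourManifolds

/-- **A four-dimensional hyperbolic link complement in the standard `S⁴`** (Ivanšić 2012, the
published proof — "one of these homotopy spheres is indeed diffeomorphic to `S⁴`. We therefore know
that `S⁴` contains a hyperbolic link of 5 tori", Martelli's survey §3.3 [cite: Martelli2015, §3.3, p. 12]
[cite: Ivansic2012, title theorem, Adv. Geom. 12 (2012) 461–482] — and, independently by Kirby
calculus, Saratchandran 2015, Theorem 4.1; the hyperbolic structure is Ivanšić's, Adv. Geom. 2004,
Thm. 4.3; cf. Ivanšić–Ratcliffe–Tschantz 2005, Rem. 4.5).  There are five pairwise disjoint smoothly embedded tori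
`T₀, …, T₄ : S¹ × S¹ ↪ S⁴` in the standard smooth 4-sphere such that the open submanifold
`U = S⁴ ∖ ⋃ Tᵢ(S¹ × S¹)` (smooth structure induced from `S⁴`) admits a complete hyperbolic metric:
a `C^∞` Riemannian metric of constant sectional curvature `−1` all of whose Levi-Civita connections
are geodesically complete.  Printed: "There exists a collection `L` of five linked 2-tori embedded
in a smooth 4-manifold `X` such that `X` is diffeomorphic to a standard `S⁴`, and `X − L` admits a
finite volume hyperbolic geometry" (finite volume not restated — module docstring).  Named fact
(D-0014). [cite: Saratchandran2015, Theorem 4.1 (= Theorem (mainthm_1) of §1)] -/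
def exists_fiveTori_hyperbolic_complement_sphereFour : Prop :=
  ∃ T : Fin 5 → ↥(Metric.sphere (0 : EuclideanSpace ℝ (Fin 2)) 1) × ↥(Metric.sphere (0 : EuclideanSpace ℝ (Fin 2)) 1) → ↥(Metric.sphere (0 : EuclideanSpace ℝ (Fin 5)) 1),
    (∀ i, Manifold.IsSmoothEmbedding ((𝓡 1).prod (𝓡 1)) (𝓡 4) ∞ (T i)) ∧
    Pairwise (fun i j => Disjoint (range (T i)) (range (T j))) ∧
    ∀ U : Opens ↥(Metric.sphere (0 : EuclideanSpace ℝ (Fin 5)) 1), (U : Set ↥(Metric.sphere (0 : EuclideanSpace ℝ (Fin 5)) 1)) = (⋃ i, range (T i))ᶜ →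
      ∃ g : Literature.Geometry.Lorentzian.PseudoRiemannianMetric (𝓡 4) ∞ (EuclideanSpace ℝ (Fin 4))
          (TangentSpace (𝓡 4) : ↥U → Type _),
        g.IsRiemannian ∧ g.HasConstantSectionalCurvature (-1) ∧
          ∀ cov, g.IsLeviCivita cov → Literature.Geometry.Lorentzian.IsGeodesicallyComplete cov

/-- **Hyperbolic complements of tori in manifolds homeomorphic to `S⁴`** (Ivanšić–Ratcliffe–Tschantz
2005, Theorem 4.4 — the two all-tori rows printed in prose: `M̃_1011`, a complement of 5 tori
(Ivanšić 2004; IRT §1), and `M̃_1091`, a complement of 9 tori (IRT Example 4.7)).  For each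
`r ∈ {5, 9}` there are a smooth closed 4-manifold `N` (Hausdorff, second countable, compact,
`C^∞`, modelled on `ℝ⁴`) which is HOMEOMORPHIC to `S⁴`, and `r` pairwise disjoint smoothly
embedded tori `Tᵢ : S¹ × S¹ ↪ N`, such that the open submanifold `N ∖ ⋃ Tᵢ(S¹ × S¹)` (smooth
structure of `N`) admits a complete Riemannian metric of constant sectional curvature `−1` (it is
the complete finite-volume hyperbolic manifold `M̃`; finite volume not restated).  The smooth type
of `N` is deliberately not asserted: "we used Freedman's theory … to recognize a 4-sphere. It is
still unknown whether manifolds homeomorphic to the 4-sphere are diffeomorphic to the `S⁴` with the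
standard differentiable structure" (Remark 4.5).  Printed: "The orientable double covers of the
nonorientable Ratcliffe–Tschantz manifolds listed in Table 1 are complements of the indicated
combination of tori and Klein bottles in a manifold that is homeomorphic to the 4-sphere."  Named
fact (D-0014). [cite: IvansicRatcliffeTschantz2005, Theorem 4.4, Remark 4.5 and Example 4.7] -/
def exists_toriComplement_homeomorphic_sphereFour : Prop :=
  ∀ r ∈ ({5, 9} : Finset ℕ),
    ∃ (N : Type) (_ : TopologicalSpace N) (_ : T2Space N) (_ : SecondCountableTopology N)
      (_ : CompactSpace N) (_ : ChartedSpace (EuclideanSpace ℝ (Fin 4)) N) (_ : IsManifold (𝓡 4) ∞ N),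
      Nonempty (N ≃ₜ ↥(Metric.sphere (0 : EuclideanSpace ℝ (Fin 5)) 1)) ∧
      ∃ T : Fin r → ↥(Metric.sphere (0 : EuclideanSpace ℝ (Fin 2)) 1) × ↥(Metric.sphere (0 : EuclideanSpace ℝ (Fin 2)) 1) → N,
        (∀ i, Manifold.IsSmoothEmbedding ((𝓡 1).prod (𝓡 1)) (𝓡 4) ∞ (T i)) ∧
        Pairwise (fun i j => Disjoint (range (T i)) (range (T j))) ∧
        ∀ U : Opens N, (U : Set N) = (⋃ i, range (T i))ᶜ →
          ∃ g : Literature.Geometry.Lorentzian.PseudoRiemannianMetric (𝓡 4) ∞ (EuclideanSpace ℝ (Fin 4))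
              (TangentSpace (𝓡 4) : ↥U → Type _),
            g.IsRiemannian ∧ g.HasConstantSectionalCurvature (-1) ∧
              ∀ cov, g.IsLeviCivita cov → Literature.Geometry.Lorentzian.IsGeodesicallyComplete cov

/-- The settled row gives the `r = 5` row of the topological statement with `N = S⁴` itself:
Saratchandran's standard-`S⁴` link complement is in particular a complement of 5 tori in a manifold
homeomorphic to `S⁴` (`Homeomorph.refl`; the standard sphere is Hausdorff, second countable, compact
and smooth). [cite: IvansicRatcliffeTschantz2005, Remark 4.5] -/
theorem exists_toriComplement_homeomorphic_sphereFour_five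
    (h : exists_fiveTori_hyperbolic_complement_sphereFour) :
    ∃ (N : Type) (_ : TopologicalSpace N) (_ : T2Space N) (_ : SecondCountableTopology N)
      (_ : CompactSpace N) (_ : ChartedSpace (EuclideanSpace ℝ (Fin 4)) N) (_ : IsManifold (𝓡 4) ∞ N),
      Nonempty (N ≃ₜ ↥(Metric.sphere (0 : EuclideanSpace ℝ (Fin 5)) 1)) ∧
      ∃ T : Fin 5 → ↥(Metric.sphere (0 : EuclideanSpace ℝ (Fin 2)) 1) × ↥(Metric.sphere (0 : EuclideanSpace ℝ (Fin 2)) 1) → N,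
        (∀ i, Manifold.IsSmoothEmbedding ((𝓡 1).prod (𝓡 1)) (𝓡 4) ∞ (T i)) ∧
        Pairwise (fun i j => Disjoint (range (T i)) (range (T j))) ∧
        ∀ U : Opens N, (U : Set N) = (⋃ i, range (T i))ᶜ →
          ∃ g : Literature.Geometry.Lorentzian.PseudoRiemannianMetric (𝓡 4) ∞ (EuclideanSpace ℝ (Fin 4))
              (TangentSpace (𝓡 4) : ↥U → Type _),
            g.IsRiemannian ∧ g.HasConstantSectionalCurvature (-1) ∧
              ∀ cov, g.IsLeviCivita cov → Literature.Geometry.Lorentzian.IsGeodesicallyComplete cov := by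
  obtain ⟨T, hT, hdisj, hU⟩ := h
  have : IsCompact (Metric.sphere (0 : EuclideanSpace ℝ (Fin 5)) 1) := isCompact_sphere _ _
  haveI : CompactSpace ↥(Metric.sphere (0 : EuclideanSpace ℝ (Fin 5)) 1) := isCompact_iff_compactSpace.mp this
  exact ⟨↥(Metric.sphere (0 : EuclideanSpace ℝ (Fin 5)) 1), inferInstance, inferInstance, inferInstance, inferInstance, inferInstance, inferInstance,
    ⟨Homeomorph.refl _⟩, T, hT, hdisj, hU⟩

end Literature.Topology.FourManifolds
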